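import Literature.Analysis.FluidPDE.CheskidovShvydkoyRegularProofs
import HarnessLib

/-!
# A Leray–Hopf solution bounded near the right end of an interval of regularity does not lose
# `H¹`-regularity there

Analysis/FluidPDE **proofs file** (theorems only: no definitions, no named facts, no `sorry`).
The continuation hypothesis of Leray's structure theorem in the tree's form
(`leray_continuation_H1`, Cheskidov–Shvydkoy 2010, Thm. 2.4: `limsup_{t → β⁻} ‖u(t)‖²_{H¹} < ∞`
at the right end `β` of every `H¹`-regular interval `(α, β)`) holds at `β` as soon as the
Leray–Hopf solution is **essentially bounded on `(β − δ, β) × ℝ³`** (Robinson–Rodrigo–Sadowski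
2016, Thm. 8.17 with `r = 2`, `s = ∞`, proof: "blowup at time `T₁` is impossible" for a solution
in a Serrin class; Leray 1934, (3.17): a regular solution stays regular while it is bounded).
Proof: restart at a good time `s ∈ (β − δ, β) ∩ (α, β)`
(`IsLerayHopfOn.exists_isLerayHopfOn_restart_Ioo`); the translate `u(· + s)` is Leray–Hopf on
`[0, β − s)`, `H¹`-regular on `(0, β − s)` and has finite Serrin integral
`∫₀^{β−s} ‖u(t + s)‖²_{L^∞} dt ≤ M² (β − s)`; the proved Serrin-class bound
`limsup_eH1NormSq_lt_top_of_serrin` (with Tao's local `H¹` theory,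
`tao2011_H1_local_almost_regular_holds`) bounds `‖u(t + s)‖_{H¹}` as `t → (β − s)⁻`, i.e.
`‖u(t)‖_{H¹}` as `t → β⁻`. This is the form in which blow-up criteria proved for classical
solutions ("`‖u(t)‖_{L^∞}` stays bounded up to `β`") feed Leray's structure theorem for weak
solutions (used for Lei–Zhang 2011, Thm. 1.4, on the path of
`LeiZhang2011_regularity_bmoStream`).

## Mathlib / tree search

Reused: `IsLerayHopfOn.exists_isLerayHopfOn_restart_Ioo`, `IsLerayHopfOn.of_le`,
`limsup_eH1NormSq_lt_top_of_serrin`, `tao2011_H1_local_almost_regular_holds`,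
`IsH1RegularOn` API (`CheskidovShvydkoyRegular`); Mathlib `eLpNormEssSup_le_of_ae_bound`,
`Filter.eventually_lt_of_limsup_lt`, `Filter.limsup_le_of_le`, `mem_nhdsLT_iff_exists_Ioo_subset`.

## References

* J. C. Robinson, J. L. Rodrigo, W. Sadowski, *The Three-Dimensional Navier–Stokes Equations*,
  CUP (2016), Thm. 8.17 and Lemma 8.16 (proof). [RobinsonRodrigoSadowski2016]
* A. Cheskidov, R. Shvydkoy, Arch. Ration. Mech. Anal. 195 (2010) = arXiv:0708.3067, Thm. 2.4.
  [CheskidovShvydkoy2010]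
-/

noncomputable section

open MeasureTheory Set Function Filter Topology
open scoped ENNReal NNReal

namespace Literature.Analysis.FluidPDE

variable {ν T : ℝ} {u₀ : EuclideanSpace ℝ (Fin 3) → EuclideanSpace ℝ (Fin 3)}
  {u : ℝ → EuclideanSpace ℝ (Fin 3) → EuclideanSpace ℝ (Fin 3)}

/-- `H¹`-regularity is invariant under time translation: if `u` is `H¹`-regular on `(α, β)` then
`u(· + s)` is `H¹`-regular on `(α − s, β − s)`. [folklore] -/
theorem IsH1RegularOn.comp_add_right {α β : ℝ} (hreg : IsH1RegularOn (Ioo α β) u) (s : ℝ) :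
    IsH1RegularOn (Ioo (α - s) (β - s)) (fun t => u (t + s)) := by
  have hmaps : MapsTo (fun t : ℝ => t + s) (Ioo (α - s) (β - s)) (Ioo α β) := fun t ht =>
    ⟨by linarith [ht.1], by linarith [ht.2]⟩
  exact ⟨fun t ht => hreg.1 (t + s) (hmaps ht),
    hreg.2.comp (continuousOn_id.add continuousOn_const) hmaps⟩

/-- **The Serrin integral of an essentially bounded translate is finite**: if
`‖u(t + s)‖ ≤ M` a.e. for `t ∈ (0, L)`, then the Serrin integral with `r = ∞` (exponent
`2/(1 − 3/∞) = 2`) is `∫_{(0,L)} ‖u(t + s)‖²_{L^∞} dt ≤ M² L < ∞`. [folklore] -/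
theorem lintegral_serrin_top_ne_top_of_ae_bound {s L M : ℝ}
    (hbd : ∀ t ∈ Ioo 0 L, ∀ᵐ x ∂volume, ‖u (t + s) x‖ ≤ M) :
    ∫⁻ t in Ioo 0 L, ENNReal.ofReal ((eLpNorm (u (t + s)) ∞ volume).toReal ^
      (2 / (1 - (3 / (∞ : ℝ≥0∞)).toReal))) ≠ ⊤ := by
  have hexp : (2 / (1 - (3 / (∞ : ℝ≥0∞)).toReal)) = 2 := by
    rw [ENNReal.div_top, ENNReal.toReal_zero, sub_zero, div_one]
  have hM : ∀ t ∈ Ioo 0 L, (eLpNorm (u (t + s)) ∞ volume).toReal ≤ max M 0 := by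
    intro t ht
    have h1 : eLpNorm (u (t + s)) ∞ volume ≤ ENNReal.ofReal (max M 0) := by
      rw [eLpNorm_exponent_top]
      exact eLpNormEssSup_le_of_ae_bound ((hbd t ht).mono fun x hx => hx.trans (le_max_left _ _))
    exact (ENNReal.toReal_mono ENNReal.ofReal_ne_top h1).trans
      (by rw [ENNReal.toReal_ofReal (le_max_right _ _)])
  have hle : ∫⁻ t in Ioo 0 L, ENNReal.ofReal ((eLpNorm (u (t + s)) ∞ volume).toReal ^
      (2 / (1 - (3 / (∞ : ℝ≥0∞)).toReal))) ≤ ∫⁻ _ in Ioo 0 L, ENNReal.ofReal (max M 0 ^ 2) := by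
    refine setLIntegral_mono' measurableSet_Ioo fun t ht => ENNReal.ofReal_le_ofReal ?_
    rw [hexp]
    have h0 : 0 ≤ (eLpNorm (u (t + s)) ∞ volume).toReal := ENNReal.toReal_nonneg
    simpa using pow_le_pow_left₀ h0 (hM t ht) 2
  refine ne_top_of_le_ne_top ?_ hle
  rw [setLIntegral_const]
  exact ENNReal.mul_ne_top ENNReal.ofReal_ne_top (measure_Ioo_lt_top (a := (0 : ℝ)) (b := L)).ne

/-- **A Leray–Hopf solution essentially bounded near the right end `β` of an interval of
`H¹`-regularity keeps `limsup_{t → β⁻} ‖u(t)‖²_{H¹} < ∞`** (the continuation hypothesis of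
`leray_continuation_H1` at `β`). Let `u` be Leray–Hopf on `ℝ³ × [0, T)` (`ν > 0`),
`H¹`-regular on `(α, β)`, `0 ≤ α < β ≤ T`, and suppose `‖u(t, x)‖ ≤ M` for a.e. `x`, for every
`t ∈ (β − δ, β)`, `δ > 0`. Then `limsup_{t → β⁻} ‖u(t)‖²_{H¹} < ∞`
(Robinson–Rodrigo–Sadowski 2016, Thm. 8.17 / Lemma 8.16, proof, in the Serrin class
`L²(β − δ', β; L^∞)`; here through a restart at a good time and the proved
`limsup_eH1NormSq_lt_top_of_serrin`). [cite: RobinsonRodrigoSadowski2016, Thm. 8.17 and Lemma 8.16 (proof)] -/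
theorem limsup_eH1NormSq_lt_top_of_ae_bound_near (hν : 0 < ν) (hLH : IsLerayHopfOn T ν 0 u₀ u)
    {α β : ℝ} (hα : 0 ≤ α) (hαβ : α < β) (hβ : β ≤ T) (hreg : IsH1RegularOn (Ioo α β) u)
    {δ M : ℝ} (hδ : 0 < δ) (hbd : ∀ t ∈ Ioo (β - δ) β, ∀ᵐ x ∂volume, ‖u t x‖ ≤ M) :
    limsup (fun t => eH1NormSq (u t)) (𝓝[<] β) < ⊤ := by
  obtain ⟨c, hc, hL2⟩ := tao2011_H1_local_almost_regular_holds
  -- a good restarting time in `(max α (β - δ), β)`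
  set a : ℝ := max α (β - δ) with ha
  have ha0 : 0 ≤ a := hα.trans (le_max_left _ _)
  have haβ : a < β := max_lt hαβ (by linarith)
  obtain ⟨s, hs, hLHs⟩ := hLH.exists_isLerayHopfOn_restart_Ioo hν.le ha0 haβ hβ
  have hαs : α < s := (le_max_left _ _).trans_lt hs.1
  have hδs : β - δ < s := (le_max_right _ _).trans_lt hs.1
  -- the translate on the horizon `β - s`
  have hLHw : IsLerayHopfOn (β - s) ν 0 (u s) (fun t => u (t + s)) := hLHs.of_le (by linarith)
  have hregw : IsH1RegularOn (Ioo 0 (β - s)) (fun t => u (t + s)) := by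
    have h := hreg.comp_add_right s
    exact h.mono (Ioo_subset_Ioo (by linarith) le_rfl)
  have hA := lintegral_serrin_top_ne_top_of_ae_bound (u := u) (s := s) (L := β - s) (M := M)
    fun t ht => hbd (t + s) ⟨by linarith [ht.1], by linarith [ht.2]⟩
  have hlim : limsup (fun t => eH1NormSq (u (t + s))) (𝓝[<] (β - s)) < ⊤ :=
    limsup_eH1NormSq_lt_top_of_serrin hL2 hc hν hLHw (r := ∞) (by simp) hA le_rfl
      (sub_pos.2 hs.2) le_rfl hregw
  -- translate the bound back to `β`
  set L : ℝ≥0∞ := limsup (fun t => eH1NormSq (u (t + s))) (𝓝[<] (β - s)) with hL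
  have hL1 : L < L + 1 := ENNReal.lt_add_right hlim.ne one_ne_zero
  have hev : ∀ᶠ t in 𝓝[<] (β - s), eH1NormSq (u (t + s)) < L + 1 :=
    Filter.eventually_lt_of_limsup_lt hL1
  obtain ⟨l, hl, hsub⟩ := mem_nhdsLT_iff_exists_Ioo_subset.1 hev
  have hev' : ∀ᶠ t in 𝓝[<] β, eH1NormSq (u t) ≤ L + 1 := by
    filter_upwards [Ioo_mem_nhdsLT (show l + s < β by linarith [mem_Iio.1 hl])] with t ht
    have h := hsub (show t - s ∈ Ioo l (β - s) from ⟨by linarith [ht.1], by linarith [ht.2]⟩)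
    simp only [mem_setOf_eq, sub_add_cancel] at h
    exact h.le
  exact lt_of_le_of_lt (Filter.limsup_le_of_le (by isBoundedDefault) hev')
    (ENNReal.add_lt_top.2 ⟨hlim, ENNReal.one_lt_top⟩)

end Literature.Analysis.FluidPDE
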